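import Summits.Parity.BatemanHorn.Theorems.SoloInformedTwinFarTailCofactors

/-!
# SoloInformedTwinFarTailPairs — which cofactor pairs carry the balanced far tail, and how many

Solo unit `solo-Parity-informed` (ideation tier, informed mode), session 48; `paper.md` §20
(Remark 20.13), `SHARPEST-STATEMENT.md` §2 Theorem F / §4L, CLAIMS C129.

Two support facts about the cofactor form `R = ∑_{m₁,m₂} C(m₁,m₂)` of the balanced far tail
(`SoloInformedTwinFarTailCofactors`, C126), both tagged [R] in paper.md Remark 20.13 so far:

* `twinCofactorTerm_eq_zero_of_not_coprime` — only COPRIME cofactor pairs carry a dilated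
  correlation: `m₁ ∣ n`, `m₂ ∣ n+2` with `n` odd, or `m₁ ∣ m`, `m₂ ∣ m+1`, force `(m₁,m₂) = 1`
  (C117's `odd_odd_coprime_of_dvd`, `coprime_of_dvd_of_dvd_add_one`); and in the odd part both
  `m₁, m₂` are odd (`twinCofactorTerm_eq_evenPart_of_even`);
* `card_effectivePairs_le` — the EFFECTIVE RANGE `m₁ ≤ A`, `m₂ ≤ B`, `(Y+1)m₁m₂ ≤ P` has at most
  `P/(Y+1) · (1 + log A)` pairs; with the programme's parameters (`A = x/(z+1)`, `P = x(x+2)`,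
  `Y = ⌊x^{1+η}⌋`, `z = ⌊x^{1/2-ε₀}⌋`) this is the `≍ x^{1-η} log x` of the prose, as an upper bound
  (`card_twinEffectivePairs_le`).

Elementary; no analytic input.
-/

namespace Summit.Parity.BatemanHorn.Theorems

open Finset

/-! ### 1. Only coprime pairs -/

/-- **Only coprime cofactor pairs carry a dilated correlation:** if `(m₁,m₂) ≠ 1` then both
progressions are empty and `C(m₁,m₂) = 0` (every `x, y, z, Y`). -/
theorem twinCofactorTerm_eq_zero_of_not_coprime {m₁ m₂ : ℕ} (h : ¬ Nat.Coprime m₁ m₂)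
    (x y z Y : ℕ) : twinCofactorTerm x y z Y m₁ m₂ = 0 := by
  unfold twinCofactorTerm
  have h1 : ((Icc 1 x).filter Odd).filter (fun n => m₁ ∣ n ∧ m₂ ∣ n + 2) = ∅ := by
    refine filter_eq_empty_iff.mpr fun n hn hd => h ?_
    exact (odd_odd_coprime_of_dvd (mem_filter.mp hn).2 hd.1 hd.2).2.2
  have h2 : (Icc 1 (x / 2)).filter (fun m => m₁ ∣ m ∧ m₂ ∣ m + 1) = ∅ := by
    refine filter_eq_empty_iff.mpr fun m _ hd => h ?_
    exact coprime_of_dvd_of_dvd_add_one hd.1 hd.2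
  rw [h1, h2, sum_empty, sum_empty, add_zero]

/-- In the odd part both cofactors are odd: if `m₁` or `m₂` is even, `C(m₁,m₂)` reduces to its
even-twin part `∑_{m ≤ x/2, m₁ ∣ m, m₂ ∣ m+1} w(m/m₁, (m+1)/m₂)`. -/
theorem twinCofactorTerm_eq_evenPart_of_even {m₁ m₂ : ℕ} (h : Even m₁ ∨ Even m₂)
    (x y z Y : ℕ) :
    twinCofactorTerm x y z Y m₁ m₂
      = ∑ m ∈ (Icc 1 (x / 2)) with (m₁ ∣ m ∧ m₂ ∣ m + 1),
          twinFarWeight y z Y (m / m₁) ((m + 1) / m₂) := by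
  unfold twinCofactorTerm
  have h1 : ((Icc 1 x).filter Odd).filter (fun n => m₁ ∣ n ∧ m₂ ∣ n + 2) = ∅ := by
    refine filter_eq_empty_iff.mpr fun n hn hd => ?_
    have hoo := odd_odd_coprime_of_dvd (mem_filter.mp hn).2 hd.1 hd.2
    rcases h with he | he
    · exact (Nat.not_even_iff_odd.mpr hoo.1) he
    · exact (Nat.not_even_iff_odd.mpr hoo.2.1) he
  rw [h1, sum_empty, zero_add]

/-! ### 2. How many effective pairs -/

/-- Multiples under a hyperbola: `#{1 ≤ m₂ ≤ B : K·m₂ ≤ P} ≤ P/K` for `K ≥ 1`. -/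
theorem card_Icc_filter_mul_le_le {K : ℕ} (hK : 0 < K) (B P : ℕ) :
    (#((Icc 1 B).filter (fun m₂ => K * m₂ ≤ P)) : ℝ) ≤ (P : ℝ) / K := by
  have hsub : (Icc 1 B).filter (fun m₂ => K * m₂ ≤ P) ⊆ Icc 1 (P / K) := by
    intro m₂ hm
    simp only [mem_filter, mem_Icc] at hm ⊢
    exact ⟨hm.1.1, (Nat.le_div_iff_mul_le hK).mpr (by simpa [mul_comm] using hm.2)⟩
  calc (#((Icc 1 B).filter (fun m₂ => K * m₂ ≤ P)) : ℝ) ≤ (#(Icc 1 (P / K)) : ℝ) := by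
        exact_mod_cast card_le_card hsub
    _ = ((P / K : ℕ) : ℝ) := by rw [Nat.card_Icc, Nat.add_sub_cancel]
    _ ≤ (P : ℝ) / K := Nat.cast_div_le

/-- **The effective range has at most `P/(Y+1)·(1 + log A)` pairs:**
`#{(m₁,m₂) : m₁ ≤ A, m₂ ≤ B, (Y+1)m₁m₂ ≤ P} ≤ P/(Y+1) · (1 + log A)`. -/
theorem card_effectivePairs_le (A B Y P : ℕ) :
    (#((Icc 1 A ×ˢ Icc 1 B).filter (fun q : ℕ × ℕ => (Y + 1) * (q.1 * q.2) ≤ P)) : ℝ)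
      ≤ (P : ℝ) / (Y + 1) * (1 + Real.log A) := by
  have hH : ∑ m ∈ Icc 1 A, (1 : ℝ) / m ≤ 1 + Real.log A := by
    have : ∑ m ∈ Icc 1 A, (1 : ℝ) / m = (harmonic A : ℝ) := by
      rw [harmonic_eq_sum_Icc]; push_cast
      exact sum_congr rfl fun m _ => one_div _
    rw [this]; exact harmonic_le_one_add_log A
  have hP0 : (0 : ℝ) ≤ (P : ℝ) / (Y + 1) := by positivity
  -- fibre the pairs over `m₁`
  rw [card_filter, sum_product]
  push_cast
  calc ∑ m₁ ∈ Icc 1 A, ∑ m₂ ∈ Icc 1 B, (if (Y + 1) * (m₁ * m₂) ≤ P then (1 : ℝ) else 0)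
      = ∑ m₁ ∈ Icc 1 A, (#((Icc 1 B).filter (fun m₂ => (Y + 1) * m₁ * m₂ ≤ P)) : ℝ) := by
        refine sum_congr rfl fun m₁ _ => ?_
        rw [card_filter]; push_cast
        refine sum_congr rfl fun m₂ _ => ?_
        rw [mul_assoc]
    _ ≤ ∑ m₁ ∈ Icc 1 A, (P : ℝ) / (((Y + 1) * m₁ : ℕ) : ℝ) := by
        refine sum_le_sum fun m₁ hm₁ => ?_
        have hm : 0 < m₁ := (mem_Icc.mp hm₁).1
        exact card_Icc_filter_mul_le_le (Nat.mul_pos (Nat.succ_pos Y) hm) B P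
    _ = (P : ℝ) / (Y + 1) * ∑ m₁ ∈ Icc 1 A, (1 : ℝ) / m₁ := by
        rw [mul_sum]
        refine sum_congr rfl fun m₁ hm₁ => ?_
        have hm : (0 : ℝ) < m₁ := by exact_mod_cast (mem_Icc.mp hm₁).1
        push_cast
        field_simp
    _ ≤ (P : ℝ) / (Y + 1) * (1 + Real.log A) := mul_le_mul_of_nonneg_left hH hP0

/-- With the programme's ranges: the effective cofactor pairs of the balanced far tail
(`m₁ ≤ x/(z+1)`, `m₂ ≤ (x+2)/(z+1)`, `(Y+1)m₁m₂ ≤ x(x+2)`) number at most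
`x(x+2)/(Y+1) · (1 + log(x/(z+1)))` — for `Y = ⌊x^{1+η}⌋`, `z = ⌊x^{1/2-ε₀}⌋` this is
`≪ x^{1-η} log x`. -/
theorem card_twinEffectivePairs_le (x z Y : ℕ) :
    (#((Icc 1 (x / (z + 1)) ×ˢ Icc 1 ((x + 2) / (z + 1))).filter
        (fun q : ℕ × ℕ => (Y + 1) * (q.1 * q.2) ≤ x * (x + 2))) : ℝ)
      ≤ ((x * (x + 2) : ℕ) : ℝ) / (Y + 1) * (1 + Real.log ((x / (z + 1) : ℕ) : ℝ)) :=
  card_effectivePairs_le _ _ _ _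

/-- Off the effective range or off the coprime pairs nothing is carried: the far tail is the sum of
`C(m₁,m₂)` over the COPRIME pairs of the cofactor box (every `x, y, z, Y`). -/
theorem twinBalancedFarSum_eq_sum_coprime_cofactorTerm (x y z Y : ℕ) :
    twinBalancedFarSum x y z Y
      = ∑ m₁ ∈ Icc 1 (x / (z + 1)), ∑ m₂ ∈ (Icc 1 ((x + 2) / (z + 1))) with Nat.Coprime m₁ m₂,
          twinCofactorTerm x y z Y m₁ m₂ := by
  rw [twinBalancedFarSum_eq_sum_cofactorTerm_range]
  refine sum_congr rfl fun m₁ _ => ?_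
  rw [sum_filter]
  refine sum_congr rfl fun m₂ _ => ?_
  split_ifs with h
  · rfl
  · exact twinCofactorTerm_eq_zero_of_not_coprime h x y z Y

end Summit.Parity.BatemanHorn.Theorems
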